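import Mathlib
import HarnessLib
import Summits.HubbardSuperconductivity.HubbardSuperconductivity.Theorems.KLProgrammeKLRegimeEngineScaleZeroV17FG8Q8U10L4
import Summits.HubbardSuperconductivity.HubbardSuperconductivity.Theorems.KLProgrammeKLRegimeEngineV8Raise

/-!
# Stub (a) `stub_engine_scale0` of the K3 ENGINE-FLOW child transported along ANY package raise `(klEngQ7 P R).IsRaiseOf Q`
# (plan g19 (R57)/K7(b): token #13 of the v2 render = `klEngQ9 P R`, a `CR`- then `CE`-raise of `klEngQ7 P R` whose BODY is frozen only on 08-29 —
# this file makes the v2-(a) re-closer a five-line instantiation whatever that body is)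

Cell `gate-hubbard-kl`, seat hubbard-kl-k3c2-p1 g5 (row «scale-0 Gram step `stub_engine_scale0`»; (R55.14) v2-(a) re-closer owner).

The five-clause conclusion of stub (a) reads the engine package `Q` only through `CE` ((E1-v4)₀, monotone), `CR` ((E2-F2)₀/(E2′-F UV)₀ via `legDressBarQ2 … 0 4`,
monotone) and `cE4` ((E4)₀) — `scaleZeroConjV17F2_mono_Q` (p538155's file).  A raise `Q₀.IsRaiseOf Q` (`…EngineV8Raise`: `CR`, `CE` weakly up, every other row pinned)
supplies exactly these three comparisons (`IsRaiseOf.CE_le/CR_le/cE4_eq`), so: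

* `scaleZeroConjV17F2_of_isRaiseOf` — the conclusion at `(G, Q₀)` gives it at `(G, Q)` for every raise `Q` of `Q₀` (`0 ≤ Q₀.CE`, `0 ≤ P.Klam`);
* `scaleZeroConjV17F2_klEng8_of_klEng7_raise` — `(klEngGeo7, klEngQ7 P R) → (klEngGeo8, Q)` for every raise `Q` of `klEngQ7 P R` (token #15's `cE4`-raise of `G` included);
* **`stub_engine_scale0_klEng8_raise`** — for ANY package family `QT P R` with `∀ P R, (klEngQ7 P R).IsRaiseOf (QT P R)`: stub (a)'s conclusion at `(klEngGeo8, QT P R)` under the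
  v1 binders (`klEngC₃6`, `klEngU₀9`, `klEngL₃`, `klEngM₃`) (at `QT := klEngQ8`, `isRaiseOf_klEngQ8` this is p546397's `stub_engine_scale0_klEng8Q8` — not restated); once
  `…EngineV8DefsQ9`/`…DefsU11` land, the v2-(a) re-closer `stub_engine_scale0 : <v2 text> := fun … => stub_engine_scale0_klEng8_raise klEngQ9 isRaiseOf_klEngQ9 … (hU.trans (klEngU₀11_le_klEngU₀9 …)) …
  (klEngL₃_le_of_klEngL₄_le hL) …` (one line per v2 binder token: #14 door, #16 volume).

Bookkeeping only; nothing about the model is asserted beyond the cited theorems; nothing asserts superconductivity.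
-/

noncomputable section

namespace Summit.HubbardSuperconductivity.HubbardSuperconductivity.Theorems.EngineV8

set_option linter.dupNamespace false -- summit = problem name (single-conjunct summit), D-0017

open Real Finset Literature.MathematicalPhysics.QuantumLattice Literature.Probability.LatticeModels
open Summit.HubbardSuperconductivity.HubbardSuperconductivity.Theorems.KLRegimeSplit
open Summit.HubbardSuperconductivity.HubbardSuperconductivity.Theorems.KLProgrammeLegKernels

section Transport

variable {L M : ℕ} [NeZero L] [NeZero M] {G : GeoConsts} {P : SplitConsts} {R : RenConsts} {Q₀ Q : EngConsts} {β U μ : ℝ}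

/-- **The five-clause conclusion of stub (a) transports along any package raise** (`Q₀.IsRaiseOf Q`, `0 ≤ Q₀.CE`, `0 ≤ P.Klam`): `CE` and `CR` only grow,
`cE4` is pinned — the three comparisons `scaleZeroConjV17F2_mono_Q` reads. -/
theorem scaleZeroConjV17F2_of_isRaiseOf (hQ : Q₀.IsRaiseOf Q) (hCE0 : 0 ≤ Q₀.CE) (hK : 0 ≤ P.Klam)
    (h : KernelNormsV4 L M P Q₀ β U μ (klFlowFrameU L M β U μ 0) 0 ∧ PairLadderStepAtV17F2 L M G P Q₀ β U μ 0 ∧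
      QuarticValueUVAtV17F L M G P Q₀ β U μ 0 ∧ EngineFirstMoments L M G P Q₀ β U μ (klFlowFrameU L M β U μ 0) 0 ∧
        IsoTupleL1AtV17F L M G P β U μ 0) :
    KernelNormsV4 L M P Q β U μ (klFlowFrameU L M β U μ 0) 0 ∧ PairLadderStepAtV17F2 L M G P Q β U μ 0 ∧
      QuarticValueUVAtV17F L M G P Q β U μ 0 ∧ EngineFirstMoments L M G P Q β U μ (klFlowFrameU L M β U μ 0) 0 ∧
        IsoTupleL1AtV17F L M G P β U μ 0 :=
  scaleZeroConjV17F2_mono_Q hCE0 hQ.CE_le hQ.CR_le hQ.cE4_eq.ge hK h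

/-- **`(klEngGeo7, klEngQ7 P R) → (klEngGeo8, Q)` for every raise `Q` of `klEngQ7 P R`** (`P.WF`): the package raise by `scaleZeroConjV17F2_of_isRaiseOf`, then token
#15 (`klEngGeo8 = klEngGeo7.raiseE4 klE4TF`: three clauses `Iff.rfl`, (E4)₀ monotone in `cE4`, (E1-v4)₀ does not read `G`). -/
theorem scaleZeroConjV17F2_klEng8_of_klEng7_raise (hP : P.WF) (hQ : (klEngQ7 P R).IsRaiseOf Q)
    (h : KernelNormsV4 L M P (klEngQ7 P R) β U μ (klFlowFrameU L M β U μ 0) 0 ∧ PairLadderStepAtV17F2 L M klEngGeo7 P (klEngQ7 P R) β U μ 0 ∧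
      QuarticValueUVAtV17F L M klEngGeo7 P (klEngQ7 P R) β U μ 0 ∧
        EngineFirstMoments L M klEngGeo7 P (klEngQ7 P R) β U μ (klFlowFrameU L M β U μ 0) 0 ∧ IsoTupleL1AtV17F L M klEngGeo7 P β U μ 0) :
    KernelNormsV4 L M P Q β U μ (klFlowFrameU L M β U μ 0) 0 ∧ PairLadderStepAtV17F2 L M klEngGeo8 P Q β U μ 0 ∧
      QuarticValueUVAtV17F L M klEngGeo8 P Q β U μ 0 ∧
        EngineFirstMoments L M klEngGeo8 P Q β U μ (klFlowFrameU L M β U μ 0) 0 ∧ IsoTupleL1AtV17F L M klEngGeo8 P β U μ 0 := by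
  have hK : 0 ≤ P.Klam := zero_le_one.trans hP.1
  obtain ⟨h1, h2, h3, h4, h5⟩ := scaleZeroConjV17F2_of_isRaiseOf hQ (klEngQ7_wf P R).1 hK h
  exact ⟨h1, pairLadderStepAtV17F2_klEngGeo8_iff.2 h2, quarticValueUVAtV17F_klEngGeo8_iff.2 h3,
    engineFirstMoments_klEngGeo8_of_klEngGeo7 hK h4, isoTupleL1AtV17F_klEngGeo8_iff.2 h5⟩

end Transport

/-- **STUB (a) AT `(klEngGeo8, QT P R)` FOR ANY RAISE FAMILY `QT` OF `klEngQ7`**, under the v1 binders (`c ≤ klEngC₃6 P R`, `U ≤ klEngU₀9 P R c`, `klEngL₃ β U ≤ L`,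
`klEngM₃ β U L ≤ M`, bare flow frame admissible): the v1 closer `stub_engine_scale0_klEng7Q7U9` (p538155) transported by `scaleZeroConjV17F2_klEng8_of_klEng7_raise`.  The v2-(a)
re-closer at the frozen token #13 (`klEngQ9`, a raise of `klEngQ7` by `isRaiseOf_klEngQ9`) is this theorem plus the two binder lines of tokens #14/#16. -/
theorem stub_engine_scale0_klEng8_raise (QT : SplitConsts → RenConsts → EngConsts) (hQT : ∀ P R, (klEngQ7 P R).IsRaiseOf (QT P R)) :
    ∀ (P : SplitConsts) (R : RenConsts) (c : ℝ), P.WF → R.WF2 → 0 < c → c ≤ klEngC₃6 P R →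
      ∀ μ ∈ klWindowC, ∀ U : ℝ, 0 < U → U ≤ klEngU₀9 P R c → ∀ β : ℝ, klBetaMin ≤ β → β ≤ Real.exp (c / U ^ 2) →
        ∀ (L M : ℕ) [NeZero L] [NeZero M], klEngL₃ β U ≤ L → klEngM₃ β U L ≤ M →
          FrameOK R U (nScales β) μ (klFlowFrameU L M β U μ 0) →
            KernelNormsV4 L M P (QT P R) β U μ (klFlowFrameU L M β U μ 0) 0 ∧
              PairLadderStepAtV17F2 L M klEngGeo8 P (QT P R) β U μ 0 ∧
                QuarticValueUVAtV17F L M klEngGeo8 P (QT P R) β U μ 0 ∧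
                  EngineFirstMoments L M klEngGeo8 P (QT P R) β U μ (klFlowFrameU L M β U μ 0) 0 ∧
                    IsoTupleL1AtV17F L M klEngGeo8 P β U μ 0 :=
  fun P R c hP hR hc hc₆ μ hμ U hU hU₉ β hβ hβc L M _ _ hL hM hK =>
    scaleZeroConjV17F2_klEng8_of_klEng7_raise hP (hQT P R)
      (stub_engine_scale0_klEng7Q7U9 P R c hP hR hc hc₆ μ hμ U hU hU₉ β hβ hβc L M hL hM hK)

end Summit.HubbardSuperconductivity.HubbardSuperconductivity.Theorems.EngineV8

end
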